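import Mathlib
import HarnessLib
import Summits.AtomisticToContinuum.Crystallization.Theorems.PricedLinkCensusSoftFourRingsFacetSides

/-!
# Soft four-rings, endgame groundwork: the slot count at a vertex

Support file for `SoftFourRings` (route `PricedLinkCensus`, sub-problem `Crystallization`),
endgame step (E0) of the evidence file (§12.8).  For a finite set `X` of unit vectors of `ℝ³`
with `0 ∈ interior (conv X)` and a point `a`:

* `sum_card_sides_at` — for any predicate `P` on pairs, summing over the facets through `a` the
  number of their sides that contain `a` and satisfy `P` counts every hull edge at `a` with `P`
  exactly twice (every hull edge lies in exactly two facets);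
* `card_facets_at_eq_card_hullEdges_at` — the number of facets through `a` equals the number of
  hull edges at `a` (every facet vertex lies on exactly two sides, `card_edgesOfFacet_filter_mem`);
* `sum_card_bond_sides_at` — the `B`-sides version: `Σ_{c ∋ a} #{B-sides of c at a} =
  2 · #{hull edges at a in B}` — the "bond slots" identity behind the vertex bookkeeping of the
  endgame.
-/

namespace Summit.AtomisticToContinuum.Crystallization.Theorems

open Real RealInnerProductSpace Literature.Geometry.DiscreteGeometry

open scoped Classical in
/-- **Double counting the (facet, side) pairs at a vertex.** -/
theorem sum_card_sides_at {X : Finset (EuclideanSpace ℝ (Fin 3))} (hX1 : ∀ y ∈ X, ‖y‖ = 1)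
    (h0 : (0 : EuclideanSpace ℝ (Fin 3)) ∈
      interior (convexHull ℝ (X : Set (EuclideanSpace ℝ (Fin 3)))))
    (a : EuclideanSpace ℝ (Fin 3)) (P : Finset (EuclideanSpace ℝ (Fin 3)) → Prop)
    [DecidablePred P] :
    ∑ c ∈ (facetNormals X).filter (fun c => a ∈ tightSet X c),
        ((edgesOfFacet X c).filter (fun T => a ∈ T ∧ P T)).card
      = 2 * ((hullEdges X).filter (fun T => a ∈ T ∧ P T)).card := by
  calc ∑ c ∈ (facetNormals X).filter (fun c => a ∈ tightSet X c),
        ((edgesOfFacet X c).filter (fun T => a ∈ T ∧ P T)).card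
      = ∑ c ∈ (facetNormals X).filter (fun c => a ∈ tightSet X c),
          ∑ T ∈ (edgesOfFacet X c).filter (fun T => a ∈ T ∧ P T), 1 := by simp
    _ = ∑ T ∈ (hullEdges X).filter (fun T => a ∈ T ∧ P T), ∑ c ∈ facetsOfEdge X T, 1 := by
        refine Finset.sum_comm' fun c T => ?_
        unfold edgesOfFacet facetsOfEdge
        simp only [Finset.mem_filter]
        constructor
        · rintro ⟨⟨hcF, -⟩, ⟨hTH, hTc⟩, haT, hP⟩
          exact ⟨⟨hcF, hTc⟩, hTH, haT, hP⟩
        · rintro ⟨⟨hcF, hTc⟩, hTH, haT, hP⟩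
          exact ⟨⟨hcF, hTc haT⟩, ⟨hTH, hTc⟩, haT, hP⟩
    _ = ∑ T ∈ (hullEdges X).filter (fun T => a ∈ T ∧ P T), 2 :=
        Finset.sum_congr rfl fun T hT => by
          rw [Finset.sum_const, smul_eq_mul, mul_one,
            card_facetsOfEdge hX1 h0 (Finset.mem_filter.1 hT).1]
    _ = 2 * ((hullEdges X).filter (fun T => a ∈ T ∧ P T)).card := by
        rw [Finset.sum_const, smul_eq_mul, mul_comm]

open scoped Classical in
/-- **As many facets as hull edges at a vertex.** -/
theorem card_facets_at_eq_card_hullEdges_at {X : Finset (EuclideanSpace ℝ (Fin 3))}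
    (hX1 : ∀ y ∈ X, ‖y‖ = 1)
    (h0 : (0 : EuclideanSpace ℝ (Fin 3)) ∈
      interior (convexHull ℝ (X : Set (EuclideanSpace ℝ (Fin 3)))))
    (a : EuclideanSpace ℝ (Fin 3)) :
    ((facetNormals X).filter (fun c => a ∈ tightSet X c)).card
      = ((hullEdges X).filter (fun T => a ∈ T)).card := by
  have h := sum_card_sides_at hX1 h0 a (fun _ => True)
  simp only [and_true] at h
  rw [Finset.sum_congr rfl (fun c hc => card_edgesOfFacet_filter_mem hX1 h0
    (Finset.mem_filter.1 hc).1 (Finset.mem_filter.1 hc).2), Finset.sum_const, smul_eq_mul] at h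
  omega

open scoped Classical in
/-- **Bond slots at a vertex**: `Σ_{facets c ∋ a} #{sides of c at a lying in B} =
2 · #{hull edges at a lying in B}`. -/
theorem sum_card_bond_sides_at {X : Finset (EuclideanSpace ℝ (Fin 3))} (hX1 : ∀ y ∈ X, ‖y‖ = 1)
    (h0 : (0 : EuclideanSpace ℝ (Fin 3)) ∈
      interior (convexHull ℝ (X : Set (EuclideanSpace ℝ (Fin 3)))))
    (B : Finset (Finset (EuclideanSpace ℝ (Fin 3)))) (a : EuclideanSpace ℝ (Fin 3)) :
    ∑ c ∈ (facetNormals X).filter (fun c => a ∈ tightSet X c),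
        ((edgesOfFacet X c).filter (fun T => a ∈ T ∧ T ∈ B)).card
      = 2 * ((hullEdges X).filter (fun T => a ∈ T ∧ T ∈ B)).card :=
  sum_card_sides_at hX1 h0 a (fun T => T ∈ B)

open scoped Classical in
/-- **Non-bond slots at a vertex**: the same count for the sides outside `B` (the `D`-edges at
`a`): `Σ_{facets c ∋ a} #{sides of c at a outside B} = 2 · d_a`. -/
theorem sum_card_nonbond_sides_at {X : Finset (EuclideanSpace ℝ (Fin 3))}
    (hX1 : ∀ y ∈ X, ‖y‖ = 1)
    (h0 : (0 : EuclideanSpace ℝ (Fin 3)) ∈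
      interior (convexHull ℝ (X : Set (EuclideanSpace ℝ (Fin 3)))))
    (B : Finset (Finset (EuclideanSpace ℝ (Fin 3)))) (a : EuclideanSpace ℝ (Fin 3)) :
    ∑ c ∈ (facetNormals X).filter (fun c => a ∈ tightSet X c),
        ((edgesOfFacet X c).filter (fun T => a ∈ T ∧ T ∉ B)).card
      = 2 * ((hullEdges X).filter (fun T => a ∈ T ∧ T ∉ B)).card :=
  sum_card_sides_at hX1 h0 a (fun T => T ∉ B)

open scoped Classical in
/-- **Splitting the two sides at a vertex**: for a facet `c ∋ a`,
`#{B-sides at a} + #{non-B sides at a} = 2`. -/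
theorem card_bond_sides_at_add {X : Finset (EuclideanSpace ℝ (Fin 3))} (hX1 : ∀ y ∈ X, ‖y‖ = 1)
    (h0 : (0 : EuclideanSpace ℝ (Fin 3)) ∈
      interior (convexHull ℝ (X : Set (EuclideanSpace ℝ (Fin 3)))))
    (B : Finset (Finset (EuclideanSpace ℝ (Fin 3)))) {c a : EuclideanSpace ℝ (Fin 3)}
    (hcF : c ∈ facetNormals X) (ha : a ∈ tightSet X c) :
    ((edgesOfFacet X c).filter (fun T => a ∈ T ∧ T ∈ B)).card
      + ((edgesOfFacet X c).filter (fun T => a ∈ T ∧ T ∉ B)).card = 2 := by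
  have h2 := card_edgesOfFacet_filter_mem hX1 h0 hcF ha
  have h := Finset.card_filter_add_card_filter_not
    (s := (edgesOfFacet X c).filter (fun T => a ∈ T)) (fun T => T ∈ B)
  rw [Finset.filter_filter, Finset.filter_filter, h2] at h
  convert h using 3

end Summit.AtomisticToContinuum.Crystallization.Theorems
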